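import Summits.Ventures.HSemireg.WedgeHankelRecurrenceGaussChebyshevSCDiscriminant

/-!
# Venture HSemireg — **NESTED CHEBYSHEV RULES (DIVISIBILITY SETTLED): `T_m ∣ T_n ⟺ m ∣ n ∧ n∕m odd`, `T_m ∣ U_{n−1} ⟺ 2m ∣ n`, `S_{m−1} ∣ S_{n−1} ⟺ m ∣ n`, `C_m ∣ C_n ⟺ m ∣ n ∧ n∕m odd`**
# (`m ≥ 1` for the `T`, `C` statements; every domain with `2 ≠ 0`, the monic `S`-statement over every nontrivial commutative ring, the `⇐` halves over any commutative ring) — node reading: the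
# `m`-point Gauss–Chebyshev rule is nested in the `n`-point one iff `n` is an odd multiple of `m`; its nodes are among the interior Clenshaw–Curtis ∕ Fejér nodes `cos(kπ∕n)` iff `2m ∣ n`;
# all from the ideal identities N458 ∕ N462 ∕ N465 ∕ N466 and a degree count

HONEST FRAMING. Part of the Lean index of the computation cell `pub-hsemireg` (seat p10 gen 48, Sunday typer «UNIFORM-IN-n»).  Polynomial ∕ ideal algebra and degree counts only; no variety, no
cohomology theory, no sheaf, no Ext group and no semiregularity map is constructed here; nothing here says that HC / HC_CM / HC_AV holds; no Literature fact (unproved `Prop`) is declared or used.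
Custodian versions as in `WedgeHankelSiegelIdeal` (1/3).
SOURCES (cited).  M. O. Rayes, V. Trevisan, P. S. Wang, Comput. Math. Appl. 50 (2005) 1231–1240, Thms 3–5 (divisibility among `T_n`, `U_n`); T. J. Rivlin, *Chebyshev Polynomials* (1990), Ex. 1.5;
J. C. Mason, D. C. Handscomb, *Chebyshev Polynomials* (2003), §2.x.
PROOF TYPED HERE.  N433 `chebyshevT_dvd_T_odd_mul`; N458 `chebyshevT_span_pair_eq_span_gcd ∕ _eq_top`; N462 `chebyshevTU_span_pair_eq_span_gcd ∕ _eq_top`; N465 `chebyshevS_span_pair_eq_span_gcd`,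
`dvd_chebyshevS_gcd`, `chebyshevS_natDegree_monic`; N466 `chebyshevC_span_pair_eq_span_gcd ∕ _eq_span_two_gcd`; `Literature…ChebyshevChains.monic_chebyshevC_and_natDegree`; Mathlib
`Ideal.span_pair_eq_span_left_iff_dvd`, `Ideal.span_singleton_eq_top`, `Ideal.mem_span_singleton`, `Polynomial.natDegree_le_of_dvd`, `natDegree_T`, `T_ne_zero`.
DEDUP DISCLOSURE (`rg -n 'chebyshevT_dvd_iff|chebyshevT_dvd_U_pred_iff|chebyshevS_pred_dvd_iff|chebyshevC_dvd_iff|chebyshevC_dvd_of' Summits Literature HarnessLib`, 2026-09-04): N456 `chebyshevU_dvd_iff`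
(the `U` statement), N433 (one direction for `T`), N438 `chebyshevU_dvd_U_mul_pred`; 0 hits for the 6 names below.

WHAT IS IN THE TREE.  N433, N438, N456, N458, N462, N465, N466.
THIS FILE (namespace `Summit.Ventures.HSemireg.Wedge.HankelOuter` continued; CHAINED on N471; 0 definitions):
* §1237 **`chebyshevS_pred_dvd_iff`**, **`chebyshevT_dvd_iff`**, `chebyshevT_dvd_U_pred_of_dvd`, **`chebyshevT_dvd_U_pred_iff`**, `chebyshevC_dvd_of`, **`chebyshevC_dvd_iff`**.
CAVEATS.  `ℕ`-division conventions as in N458.  Nothing Ext-side.  New names only.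
-/

open Module Polynomial
open scoped Matrix Polynomial

namespace Summit.Ventures.HSemireg.Wedge.HankelOuter

/-! ## §1237. Nested rules: divisibility among `T_n`, `U_n`, `S_n`, `C_n` -/

/-- **`S_{m−1} ∣ S_{n−1} ⟺ m ∣ n`** over every nontrivial commutative ring (monic strong divisibility sequence). [Hoggatt–Long 1974; this file, §1237] -/
theorem chebyshevS_pred_dvd_iff {R : Type*} [CommRing R] [Nontrivial R] (m n : ℕ) :
    Polynomial.Chebyshev.S R ((m : ℤ) - 1) ∣ Polynomial.Chebyshev.S R ((n : ℤ) - 1) ↔ m ∣ n := by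
  constructor
  · intro h
    have hg := dvd_chebyshevS_gcd (dvd_refl _) h
    -- degree count: `m ≤ gcd(m,n)`
    rcases Nat.eq_zero_or_pos m with rfl | hm
    · rw [Nat.cast_zero, zero_sub, Polynomial.Chebyshev.S_neg_one, zero_dvd_iff] at h
      rcases Nat.eq_zero_or_pos n with rfl | hn
      · exact dvd_refl 0
      · obtain ⟨k, rfl⟩ : ∃ k, n = k + 1 := ⟨n - 1, by omega⟩
        rw [show (((k + 1 : ℕ)) : ℤ) - 1 = (k : ℤ) by push_cast; ring] at h
        exact absurd h (chebyshevS_natDegree_monic (R := R) k).2.ne_zero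
    · obtain ⟨m', rfl⟩ : ∃ m', m = m' + 1 := ⟨m - 1, by omega⟩
      have hgpos : 0 < Nat.gcd (m' + 1) n := Nat.gcd_pos_of_pos_left n hm
      obtain ⟨g', hg'⟩ : ∃ g', Nat.gcd (m' + 1) n = g' + 1 := ⟨Nat.gcd (m' + 1) n - 1, by omega⟩
      rw [hg', show (((m' + 1 : ℕ)) : ℤ) - 1 = (m' : ℤ) by push_cast; ring, show (((g' + 1 : ℕ)) : ℤ) - 1 = (g' : ℤ) by push_cast; ring] at hg
      obtain ⟨r, hr⟩ := hg
      have hr0 : r ≠ 0 := by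
        rintro rfl
        rw [mul_zero] at hr
        exact (chebyshevS_natDegree_monic (R := R) g').2.ne_zero hr
      have hle : m' ≤ g' := by
        have e := congrArg Polynomial.natDegree hr
        rw [(chebyshevS_natDegree_monic (R := R) m').2.natDegree_mul' hr0, (chebyshevS_natDegree_monic (R := R) m').1, (chebyshevS_natDegree_monic (R := R) g').1] at e
        omega
      have hgle : Nat.gcd (m' + 1) n ≤ m' + 1 := Nat.gcd_le_left n hm
      have heq : Nat.gcd (m' + 1) n = m' + 1 := by omega
      exact heq ▸ Nat.gcd_dvd_right (m' + 1) n
  · intro h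
    rw [← Ideal.mem_span_singleton, ← Nat.gcd_eq_left h, ← chebyshevS_span_pair_eq_span_gcd]
    exact Ideal.subset_span (Set.mem_insert_of_mem _ (Set.mem_singleton _))

/-- **`T_m ∣ T_n ⟺ m ∣ n ∧ n∕m odd`** (`m ≥ 1`; every domain with `2 ≠ 0`): the `m`-point Gauss–Chebyshev rule is nested in the `n`-point rule exactly for odd multiples.
[Rayes–Trevisan–Wang 2005 Thm 3; this file, §1237] -/
theorem chebyshevT_dvd_iff {R : Type*} [CommRing R] [IsDomain R] [NeZero (2 : R)] {m : ℕ} (hm : 0 < m) (n : ℕ) :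
    Polynomial.Chebyshev.T R (m : ℤ) ∣ Polynomial.Chebyshev.T R (n : ℤ) ↔ m ∣ n ∧ Odd (n / m) := by
  constructor
  · intro h
    have hspan : Ideal.span {Polynomial.Chebyshev.T R (m : ℤ), Polynomial.Chebyshev.T R (n : ℤ)} = Ideal.span {Polynomial.Chebyshev.T R (m : ℤ)} :=
      Ideal.span_pair_eq_span_left_iff_dvd.2 h
    by_cases hP : Odd (m / Nat.gcd m n) ∧ Odd (n / Nat.gcd m n)
    · rw [chebyshevT_span_pair_eq_span_gcd hP] at hspan
      have hdvd : Polynomial.Chebyshev.T R (m : ℤ) ∣ Polynomial.Chebyshev.T R (Nat.gcd m n : ℤ) := by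
        rw [← Ideal.mem_span_singleton, ← hspan]; exact Ideal.mem_span_singleton_self _
      have hle := Polynomial.natDegree_le_of_dvd hdvd (Polynomial.Chebyshev.T_ne_zero R _)
      rw [Polynomial.Chebyshev.natDegree_T, Polynomial.Chebyshev.natDegree_T, Int.natAbs_natCast, Int.natAbs_natCast] at hle
      have heq : Nat.gcd m n = m := le_antisymm (Nat.gcd_le_left n hm) hle
      rw [heq] at hP
      exact ⟨heq ▸ Nat.gcd_dvd_right m n, hP.2⟩
    · rw [chebyshevT_span_pair_eq_top hP, eq_comm, Ideal.span_singleton_eq_top] at hspan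
      have hdeg := Polynomial.natDegree_eq_zero_of_isUnit hspan
      rw [Polynomial.Chebyshev.natDegree_T, Int.natAbs_natCast] at hdeg
      omega
  · rintro ⟨⟨k, rfl⟩, hodd⟩
    rw [Nat.mul_div_cancel_left k hm] at hodd
    rw [Nat.cast_mul, mul_comm]
    exact chebyshevT_dvd_T_odd_mul (Odd.natCast hodd) (m : ℤ)

/-- `2m ∣ n ⇒ T_m ∣ U_{n−1}` over every commutative ring (`U_{2m−1} = 2 T_m U_{m−1}` and strong divisibility). [this file, §1237] -/
theorem chebyshevT_dvd_U_pred_of_dvd {R : Type*} [CommRing R] {m n : ℕ} (h : 2 * m ∣ n) :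
    Polynomial.Chebyshev.T R (m : ℤ) ∣ Polynomial.Chebyshev.U R ((n : ℤ) - 1) := by
  rcases Nat.eq_zero_or_pos m with rfl | hm
  · rw [Nat.cast_zero, Polynomial.Chebyshev.T_zero]; exact one_dvd _
  obtain ⟨k, rfl⟩ := h
  have hg : Nat.gcd m (2 * m * k) = m := Nat.gcd_eq_left ⟨2 * k, by ring⟩
  have heven : Even (2 * m * k / Nat.gcd m (2 * m * k)) := by
    rw [hg, show 2 * m * k = m * (2 * k) by ring, Nat.mul_div_cancel_left _ hm]; exact even_two_mul k
  have key := chebyshevTU_span_pair_eq_span_gcd (R := R) heven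
  rw [hg] at key
  rw [← Ideal.mem_span_singleton, ← key]
  exact Ideal.subset_span (Set.mem_insert_of_mem _ (Set.mem_singleton _))

/-- **`T_m ∣ U_{n−1} ⟺ 2m ∣ n`** (`m ≥ 1`; every domain with `2 ≠ 0`): the Gauss–Chebyshev nodes of order `m` are among the nodes `cos(kπ∕n)` exactly when `2m ∣ n`. [Rayes–Trevisan–Wang
2005 §4; this file, §1237] -/
theorem chebyshevT_dvd_U_pred_iff {R : Type*} [CommRing R] [IsDomain R] [NeZero (2 : R)] {m : ℕ} (hm : 0 < m) (n : ℕ) :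
    Polynomial.Chebyshev.T R (m : ℤ) ∣ Polynomial.Chebyshev.U R ((n : ℤ) - 1) ↔ 2 * m ∣ n := by
  refine ⟨fun h => ?_, chebyshevT_dvd_U_pred_of_dvd⟩
  have hspan : Ideal.span {Polynomial.Chebyshev.T R (m : ℤ), Polynomial.Chebyshev.U R ((n : ℤ) - 1)} = Ideal.span {Polynomial.Chebyshev.T R (m : ℤ)} :=
    Ideal.span_pair_eq_span_left_iff_dvd.2 h
  by_cases hP : Even (n / Nat.gcd m n)
  · rw [chebyshevTU_span_pair_eq_span_gcd hP] at hspan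
    have hdvd : Polynomial.Chebyshev.T R (m : ℤ) ∣ Polynomial.Chebyshev.T R (Nat.gcd m n : ℤ) := by
      rw [← Ideal.mem_span_singleton, ← hspan]; exact Ideal.mem_span_singleton_self _
    have hle := Polynomial.natDegree_le_of_dvd hdvd (Polynomial.Chebyshev.T_ne_zero R _)
    rw [Polynomial.Chebyshev.natDegree_T, Polynomial.Chebyshev.natDegree_T, Int.natAbs_natCast, Int.natAbs_natCast] at hle
    have heq : Nat.gcd m n = m := le_antisymm (Nat.gcd_le_left n hm) hle
    rw [heq] at hP
    obtain ⟨k, hk⟩ := hP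
    refine ⟨k, ?_⟩
    have hmn : m ∣ n := heq ▸ Nat.gcd_dvd_right m n
    rw [← Nat.div_mul_cancel hmn, hk]; ring
  · rw [chebyshevTU_span_pair_eq_top hP, eq_comm, Ideal.span_singleton_eq_top] at hspan
    have hdeg := Polynomial.natDegree_eq_zero_of_isUnit hspan
    rw [Polynomial.Chebyshev.natDegree_T, Int.natAbs_natCast] at hdeg
    omega

/-- `m ∣ n`, `n∕m` odd ⇒ `C_m ∣ C_n` over every commutative ring. [Lidl–Mullen–Turnwald Ch. 2; this file, §1237] -/
theorem chebyshevC_dvd_of {R : Type*} [CommRing R] {m n : ℕ} (hmn : m ∣ n) (hodd : Odd (n / m)) :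
    Polynomial.Chebyshev.C R (m : ℤ) ∣ Polynomial.Chebyshev.C R (n : ℤ) := by
  rcases Nat.eq_zero_or_pos m with rfl | hm
  · rw [Nat.div_zero] at hodd; exact absurd hodd Nat.not_odd_zero
  have hg : Nat.gcd m n = m := Nat.gcd_eq_left hmn
  have hP : Odd (m / Nat.gcd m n) ∧ Odd (n / Nat.gcd m n) := by rw [hg, Nat.div_self hm]; exact ⟨odd_one, hodd⟩
  rw [← Ideal.mem_span_singleton, ← hg, ← chebyshevC_span_pair_eq_span_gcd hP]
  exact Ideal.subset_span (Set.mem_insert_of_mem _ (Set.mem_singleton _))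

/-- **`C_m ∣ C_n ⟺ m ∣ n ∧ n∕m odd`** (`m ≥ 1`; every domain with `2 ≠ 0`; Dickson ∕ Vieta–Lucas polynomials). [Lidl–Mullen–Turnwald Ch. 2; this file, §1237] -/
theorem chebyshevC_dvd_iff {R : Type*} [CommRing R] [IsDomain R] [NeZero (2 : R)] {m : ℕ} (hm : 0 < m) (n : ℕ) :
    Polynomial.Chebyshev.C R (m : ℤ) ∣ Polynomial.Chebyshev.C R (n : ℤ) ↔ m ∣ n ∧ Odd (n / m) := by
  refine ⟨fun h => ?_, fun h => chebyshevC_dvd_of h.1 h.2⟩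
  obtain ⟨m', rfl⟩ : ∃ m', m = m' + 1 := ⟨m - 1, by omega⟩
  obtain ⟨hmonic, hdegC⟩ := Literature.Algebra.Polynomial.ChebyshevChains.monic_chebyshevC_and_natDegree (R := R) m'
  have hspan : Ideal.span {Polynomial.Chebyshev.C R (((m' + 1 : ℕ)) : ℤ), Polynomial.Chebyshev.C R (n : ℤ)} = Ideal.span {Polynomial.Chebyshev.C R (((m' + 1 : ℕ)) : ℤ)} :=
    Ideal.span_pair_eq_span_left_iff_dvd.2 h
  by_cases hP : Odd ((m' + 1) / Nat.gcd (m' + 1) n) ∧ Odd (n / Nat.gcd (m' + 1) n)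
  · rw [chebyshevC_span_pair_eq_span_gcd hP] at hspan
    have hdvd : Polynomial.Chebyshev.C R (((m' + 1 : ℕ)) : ℤ) ∣ Polynomial.Chebyshev.C R (Nat.gcd (m' + 1) n : ℤ) := by
      rw [← Ideal.mem_span_singleton, ← hspan]; exact Ideal.mem_span_singleton_self _
    have hgpos : 0 < Nat.gcd (m' + 1) n := Nat.gcd_pos_of_pos_left n hm
    obtain ⟨g', hg'⟩ : ∃ g', Nat.gcd (m' + 1) n = g' + 1 := ⟨Nat.gcd (m' + 1) n - 1, by omega⟩
    rw [hg'] at hdvd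
    have hle := Polynomial.natDegree_le_of_dvd hdvd (Literature.Algebra.Polynomial.ChebyshevChains.monic_chebyshevC_and_natDegree (R := R) g').1.ne_zero
    rw [hdegC, (Literature.Algebra.Polynomial.ChebyshevChains.monic_chebyshevC_and_natDegree (R := R) g').2] at hle
    have heq : Nat.gcd (m' + 1) n = m' + 1 := by have := Nat.gcd_le_left n hm; omega
    rw [heq, Nat.div_self hm] at hP
    exact ⟨heq ▸ Nat.gcd_dvd_right (m' + 1) n, hP.2⟩
  · rw [chebyshevC_span_pair_eq_span_two_gcd hP] at hspan
    have h2 : Polynomial.Chebyshev.C R (((m' + 1 : ℕ)) : ℤ) ∣ (2 : R[X]) := by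
      rw [← Ideal.mem_span_singleton, ← hspan]; exact Ideal.subset_span (Set.mem_insert _ _)
    have hle := Polynomial.natDegree_le_of_dvd h2 (by rw [show (2 : R[X]) = Polynomial.C 2 from (Polynomial.C_ofNat 2).symm]; exact Polynomial.C_ne_zero.2 (NeZero.ne 2))
    rw [hdegC, show (2 : R[X]) = Polynomial.C 2 from (Polynomial.C_ofNat 2).symm, natDegree_C] at hle
    omega

end Summit.Ventures.HSemireg.Wedge.HankelOuter
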